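import Literature.Probability.RandomPlanarGeometry.SLEBubblesSchwarzianMass
import Literature.Probability.RandomPlanarGeometry.StarHullOneStepClean
import HarnessLib

/-!
# One step of the conformal image of a Loewner chain, VI: the image driving value `W̃ = h_t(W_t)`

Deterministic core of the **locality of SLE₆** (G. F. Lawler, O. Schramm, W. Werner, *Values of
Brownian intersection exponents I*, Acta Math. **187** (2001), Thm. 2.2; in the form of G. F.
Lawler, O. Schramm, W. Werner, *Conformal restriction: the chordal case*, J. Amer. Math. Soc.
**16** (2003) (**[LSW]**), §5, remark after (5.1): "`W̃_t = h_t(W_t)` … `dW̃_t = h_t'(W_t) dW_t +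
(κ/2 − 3) h_t''(W_t) dt` … at `κ = 6` … `W̃` is a local martingale … this gives a new proof of the
locality of SLE₆"; G. F. Lawler, *Conformally Invariant Processes in the Plane* (2005), §4.6.1
(4.34)–(4.35) and §6.3 Prop. 6.13–6.14), in the ONE-STEP language of the tree
(`LoewnerImageStep*`, `StarHullCanonical`, `StarHullOneStep`).

Setting ([LSW] §5 / `SLERestrictionMartingale.slidHull`): `A ∈ 𝒬*`, `g_t` the Loewner maps of the
driving function `W`, `A_t = g_t(A)`, `h_t = g_{A_t}` the hydrodynamically normalized map, and
`B_t = A_t − W_t` the hull seen from the tip. The conformal image `γ̃ = Φ_A(γ)` of the curve is,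
after reparametrisation by its capacity, the Loewner chain of the maps
`g̃ = g_{A_t} ∘ g_t ∘ Φ_A⁻¹ + L_A` with the **image driving value**

  `W̃_t = g̃(γ̃_t) = h_t(W_t) + L_A = W_t + L_A − L_{B_t}`,    `L_B = starShift B = −g_B(0)`

(`Φ_B(z) = g_B(z) − g_B(0)`, `StarHullExtension.hullShift`). Over ONE STEP of the flow from the hull
`B = B_s` with increment driver `U = W_{s+·} − W_s` run for time `u` (new hull
`B' = slidHull U B u = B_{s+u}`), the increment of `W̃` is therefore the number

  `imageDriverStep B U u = U_u + L_B − L_{B'} = h'(U_u) − h(0)`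

(`h = E_B − L_B`, `h'(z) = E_{B'}(z − U_u) − L_{B'} + U_u`, the two hydrodynamic maps of
`StarHullCanonical.starStep`; `ofReal_imageDriverStep`). We PROVE its second-order expansion in
`x = U_u` and first-order expansion in `u`:

  `|ΔW̃ − (d x + c₂ x²/2 − 3 c₂ u)| ≤ C(d, ρ₀) u (η ρ₀ + u) + (384/ρ₀²) u |x| + |x|³/(3ρ₀²) + (8/ρ₀³) |x|⁴`

(`abs_imageDriverStep_sub_model_le`; `d = Φ_B'(0) = h_t'(W_t)`, `c₂ = E_B''(0) = h_t''(W_t)`,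
`η = stepSize S u` the size of the increment hull), from `h' − h = 2u D + O(u(η + u))`
(`norm_starStep_sub_drift_le`, Lawler's Prop. 4.40), **`D(0) = −(3/2) E_B''(0)`**
(`driftFun_zero`, Lawler's (4.35) `∂_t h_t(W_t) = −3 h_t''(W_t)`) and the Taylor expansion of
`E_B` at `0` (`norm_hullExt_sub_taylor_le`). Over a Brownian increment (`E x = 0`, `E x² = κ u`)
the model `imageDriverModel d c₂ u x = d x + c₂ x²/2 − 3 c₂ u` has mean
`u · imageDriverDrift κ c₂`, `imageDriverDrift κ c₂ = (κ/2 − 3) c₂` — the drift of [LSW]'s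
display, which **vanishes identically at `κ = 6`** (`imageDriverDrift_six`), while the martingale
part `d x` has variance `κ d² u`: the discrete skeleton of
`dW̃ = h_t'(W_t) dW_t + (κ/2 − 3) h_t''(W_t) dt`, `d⟨W̃⟩ = κ h_t'(W_t)² dt`.

Also: the crude bound `|ΔW̃| ≤ 25u/ρ₀ + 2|x|` (`abs_imageDriverStep_le`: `t ↦ W̃_t` is continuous
along the flow) and the clean form of the remainder for hulls of a controlled class,
`K · (u η + u² + |x|³ + u |x|)` with `K = stepK δ₀ ρ₀` (`abs_imageDriverStep_sub_model_le_clean`),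
the format consumed by the conditional-increment estimates of `SLERestrictionOneStep`.

No named fact; three explicit definitions (`imageDriverStep`, `imageDriverModel`,
`imageDriverDrift`).

## References

* [LSW] 2003, §5 (5.1) and the remark following it. [LawlerSchrammWerner2003Restriction]
* G. F. Lawler, O. Schramm, W. Werner, Acta Math. 187 (2001), Thm. 2.2. [LawlerSchrammWerner2001]
* G. F. Lawler (2005), §4.6.1 (4.34)–(4.35), Prop. 4.40; §6.3 Prop. 6.13. [Lawler2005]
-/

noncomputable section

open Set Filter Metric Function
open _root_.Complex _root_.Topology _root_.Real
open UpperHalfPlane (upperHalfPlaneSet)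
open scoped NNReal

namespace Literature.Probability.RandomPlanarGeometry

namespace Loewner

/-! ### The image driving value over one step, and its model -/

/-- **The increment of the image driving value over one step**: `ΔW̃ = U_u + L_B − L_{B'}`,
`B' = slidHull U B u`, `L = starShift` (in slid coordinates `W̃_t = W_t + L_A − L_{A_t − W_t}`,
[LSW] §5: `W̃_t = h_t(W_t)`). [cite: LawlerSchrammWerner2003Restriction, §5 (W̃_t = h_t(W_t))] -/
def imageDriverStep (B : Set ℂ) (U : ℝ≥0 → ℝ) (u : ℝ≥0) : ℝ :=
  U u + (starShift B).re - (starShift (slidHull U B u)).re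

/-- **The model of the increment**: `d x + c₂ x²/2 − 3 c₂ u` (`d = h_t'(W_t)`, `c₂ = h_t''(W_t)`;
Itô: `h' dW + ½ h'' d⟨W⟩ + ∂_t h dt` with `∂_t h_t(W_t) = −3 h_t''(W_t)`, Lawler (4.35)).
[cite: Lawler2005, §4.6.1 (4.35)] -/
def imageDriverModel (d c₂ : ℝ) (u : ℝ≥0) (x : ℝ) : ℝ :=
  d * x + c₂ * x ^ 2 / 2 - 3 * c₂ * u

/-- **The drift per unit time of `W̃` under the SLE_κ driving function**: `(κ/2 − 3) c₂`
([LSW] §5: `dW̃_t = h_t'(W_t) dW_t + (κ/2 − 3) h_t''(W_t) dt`).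
[cite: LawlerSchrammWerner2003Restriction, §5 (remark after (5.1))] -/
def imageDriverDrift (κ c₂ : ℝ) : ℝ := (κ / 2 - 3) * c₂

/-- The model is `d x + (c₂/2)(x² − κ u) + u · imageDriverDrift κ c₂`: over an increment with
`E x = 0`, `E x² = κ u` its mean is `u (κ/2 − 3) c₂`. [folklore] -/
theorem imageDriverModel_eq (d c₂ : ℝ) (u : ℝ≥0) (x κ : ℝ) :
    imageDriverModel d c₂ u x = d * x + c₂ / 2 * (x ^ 2 - κ * u) + u * imageDriverDrift κ c₂ := by
  rw [imageDriverModel, imageDriverDrift]; ring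

/-- **The drift vanishes at `κ = 6`**: this is the locality of SLE₆ at the level of the
driving process ([LSW] §5; Lawler (2005), Prop. 6.13). [cite: LawlerSchrammWerner2003Restriction, §5 (remark after (5.1))] -/
@[simp] theorem imageDriverDrift_six (c₂ : ℝ) : imageDriverDrift 6 c₂ = 0 := by
  rw [imageDriverDrift]; norm_num

/-- Conversely the drift vanishes for all hulls only at `κ = 6` (`c₂ ≠ 0` for some hull).
[folklore] -/
theorem imageDriverDrift_eq_zero_iff {κ c₂ : ℝ} (hc₂ : c₂ ≠ 0) : imageDriverDrift κ c₂ = 0 ↔ κ = 6 := by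
  rw [imageDriverDrift, mul_eq_zero, or_iff_left hc₂]
  constructor <;> intro h <;> linarith

/-! ### The step through the hydrodynamic maps -/

variable {B : Set ℂ} {ρ₀ : ℝ} {U : ℝ≥0 → ℝ} {u : ℝ≥0} {S : ℝ}
variable (hB : IsStarHull B) (hU : Continuous U) (hU0 : U 0 = 0) (hu : 0 < u)
  (hS : ∀ v : ℝ≥0, v ≤ u → |U v| ≤ S) (hρ₀ : 0 < ρ₀) (hBρ : Disjoint (ball (0 : ℂ) (8 * ρ₀)) B)
  (hη : stepSize S u ≤ starDeriv B * ρ₀ / 1000)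

/-- A real constant of the canonical data, as a complex number: `L_B = (L_B.re : ℂ)`. [folklore] -/
theorem starShift_eq_ofReal_re (h : IsStarHull B) : starShift B = ((starShift B).re : ℂ) :=
  Complex.ext (by simp) (by simp [starShift_im h])

include hB hU hU0 hS hρ₀ hBρ hη in
/-- **`ΔW̃ = h'(U_u) − h(0) = starStep(U_u) + E_B(U_u)`**: the increment of the image driving value
is the one-step difference of the hydrodynamic maps at the new tip plus the displacement of the old
map (`h(0) = −L_B`, `E_{B'}(0) = 0`). [cite: Lawler2005, §4.6.1 (4.34)] -/
theorem ofReal_imageDriverStep :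
    (imageDriverStep B U u : ℂ) = starStep B U u (U u) + starMap B (U u) := by
  obtain ⟨-, hB'⟩ := isStarHull_slidHull_canonical hB hU hU0 hS hρ₀ hBρ hη
  rw [imageDriverStep, starStep, sub_self, starMap_zero hB']
  push_cast
  rw [← starShift_eq_ofReal_re hB, ← starShift_eq_ofReal_re hB']
  ring

include hB hU hU0 hu hS hρ₀ hBρ hη in
/-- **The crude bound `|ΔW̃| ≤ 25u/ρ₀ + 2|U_u|`** (`|h' − h| ≤ 25u/ρ₀` on `|z| ≤ ρ₀` and
`|E_B'| ≤ 2` near `0`): along the flow `t ↦ W̃_t` is continuous.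
[cite: LawlerSchrammWerner2003Restriction, §5 (W̃ continuous)] -/
theorem abs_imageDriverStep_le : |imageDriverStep B U u| ≤ 25 * u / ρ₀ + 2 * |U u| := by
  obtain ⟨hUu, hη1, hη0⟩ := abs_driver_le hB hu hS hρ₀ hη
  have hΦ := isRestrictionMap_starRMap hB
  set x : ℝ := U u with hx
  have hxn : ‖(x : ℂ)‖ = |x| := by rw [norm_real, Real.norm_eq_abs]
  have hxρ : |x| ≤ ρ₀ / 1000 := hUu.trans hη1
  have h1 := norm_starStep_le hB hU hU0 hu hS hρ₀ hBρ hη (z := x) (by rw [hxn]; linarith)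
  -- `|E_B(x)| ≤ 2|x|` by the mean value inequality on `B(0, 4ρ₀)`
  obtain ⟨h1', -, -, -⟩ := norm_iteratedDeriv_hullExt_le hB hΦ hρ₀ hBρ
  have hE : DifferentiableOn ℂ (starMap B) (ball (0 : ℂ) (4 * ρ₀)) := differentiableOn_starMap hB hρ₀ hBρ
  have h2 : ‖starMap B x‖ ≤ 2 * |x| := by
    have := (convex_ball (0 : ℂ) (4 * ρ₀)).norm_image_sub_le_of_norm_deriv_le (f := starMap B) (C := 2)
      (fun w hw ↦ hE.differentiableAt (isOpen_ball.mem_nhds hw))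
      (fun w hw ↦ by rw [starMap_eq hB]; exact h1' w hw) (mem_ball_self (by positivity))
      (mem_ball_zero_iff.2 (show ‖(x : ℂ)‖ < 4 * ρ₀ by rw [hxn]; linarith))
    rwa [starMap_zero hB, sub_zero, sub_zero, hxn] at this
  have h := ofReal_imageDriverStep hB hU hU0 hS hρ₀ hBρ hη
  rw [← Real.norm_eq_abs, ← norm_real, h]
  exact (norm_add_le _ _).trans (add_le_add h1 h2)

include hB hU hU0 hu hS hρ₀ hBρ hη in
/-- **The expansion of `ΔW̃`** ([LSW] §5 / Lawler (4.34)–(4.35), quantitative, deterministic):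
with `x = U_u`, `η = stepSize S u`, `d = Φ_B'(0)`, `c₂ = E_B''(0)`,

  `|ΔW̃ − (d x + c₂ x²/2 − 3 c₂ u)|`
  `≤ 25000 u (η ρ₀ + u)/(d ρ₀³) + (384/ρ₀²) u |x| + |x|³/(3 ρ₀²) + (8/ρ₀³) |x|⁴`:

`ΔW̃ = [h'(x) − h(x) − 2u D(x)] + 2u [D(x) − D(0)] + (2u D(0) + 3 c₂ u) + E_B(x)` with
`D(0) = −(3/2) c₂`, `|D'| ≤ 192/ρ₀²` near `0`, and
`E_B(x) = d x + c₂ x²/2 + c₃ x³/6 + O(|x|⁴)`, `|c₃| ≤ 2/ρ₀²`.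
[cite: LawlerSchrammWerner2003Restriction, §5 (remark after (5.1)); Lawler2005, (4.35)] -/
theorem abs_imageDriverStep_sub_model_le :
    |imageDriverStep B U u - imageDriverModel (starDeriv B) (starJet2 B) u (U u)| ≤
      25000 * u * (stepSize S u * ρ₀ + u) / (starDeriv B * ρ₀ ^ 3) + 384 / ρ₀ ^ 2 * u * |U u| +
        1 / (3 * ρ₀ ^ 2) * |U u| ^ 3 + 8 / ρ₀ ^ 3 * |U u| ^ 4 := by
  obtain ⟨hUu, hη1, hη0⟩ := abs_driver_le hB hu hS hρ₀ hη
  obtain ⟨hd0, hd1, hd⟩ := starDeriv_spec hB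
  have hΦ := isRestrictionMap_starRMap hB
  obtain ⟨e2, e3, hc2, hc3, -⟩ := starJet_spec hB hρ₀ hBρ
  set x : ℝ := U u with hx
  have hxn : ‖(x : ℂ)‖ = |x| := by rw [norm_real, Real.norm_eq_abs]
  have hxρ : |x| ≤ ρ₀ / 1000 := hUu.trans hη1
  have hu0 : (0 : ℝ) ≤ u := u.coe_nonneg
  -- (1) the step minus the drift at `z = x`
  have h1 := norm_starStep_sub_drift_le hB hU hU0 hu hS hρ₀ hBρ hη (z := x) (by rw [hxn]; linarith)
  -- (2) `D(x) − D(0)` by the mean value inequality, `|D'| ≤ 192/ρ₀²` on `B̄(0, ρ₀/8)`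
  obtain ⟨-, hD1, -⟩ := norm_driftFun_le hB hΦ hd hρ₀ hBρ
  have hDd := differentiableOn_starDrift hB hρ₀ hBρ (ρ₀ := ρ₀)
  have h2 : ‖starDrift B ρ₀ x - starDrift B ρ₀ 0‖ ≤ 192 / ρ₀ ^ 2 * |x| := by
    have hsub : closedBall (0 : ℂ) (ρ₀ / 8) ⊆ ball (0 : ℂ) (ρ₀ / 2) := closedBall_subset_ball (by linarith)
    have := (convex_closedBall (0 : ℂ) (ρ₀ / 8)).norm_image_sub_le_of_norm_deriv_le (f := starDrift B ρ₀)
      (C := 192 / ρ₀ ^ 2) (fun w hw ↦ hDd.differentiableAt (isOpen_ball.mem_nhds (hsub hw)))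
      (fun w hw ↦ by rw [starDrift_eq hB]; exact hD1 w hw) (mem_closedBall_self (by positivity))
      (mem_closedBall_zero_iff.2 (show ‖(x : ℂ)‖ ≤ ρ₀ / 8 by rw [hxn]; linarith))
    rwa [sub_zero, hxn] at this
  -- (3) `D(0) = −(3/2) c₂`
  have h3 : starDrift B ρ₀ 0 = -(3 / 2 : ℂ) * (starJet2 B : ℂ) := by
    rw [starDrift_eq hB, driftFun_zero hB hΦ hd hρ₀ hBρ, ← starMap_eq hB, e2]
  -- (4) Taylor of `E_B` at `0`
  have h4 := norm_hullExt_sub_taylor_le hB hΦ hd hρ₀ hBρ (z := x) (by rw [hxn]; linarith)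
  rw [← starMap_eq hB, e2, e3, hxn] at h4
  -- combine
  have hid : ((imageDriverStep B U u - imageDriverModel (starDeriv B) (starJet2 B) u x : ℝ) : ℂ) =
      (starStep B U u x - 2 * (u : ℂ) * starDrift B ρ₀ x) +
        2 * (u : ℂ) * (starDrift B ρ₀ x - starDrift B ρ₀ 0) +
        (starJet3 B : ℂ) / 6 * x ^ 3 +
        (starMap B x - ((starDeriv B : ℂ) * x + (starJet2 B : ℂ) / 2 * x ^ 2 + (starJet3 B : ℂ) / 6 * x ^ 3)) := by
    rw [ofReal_sub, ofReal_imageDriverStep hB hU hU0 hS hρ₀ hBρ hη, h3, imageDriverModel]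
    push_cast
    ring
  rw [← Real.norm_eq_abs, ← norm_real, hid]
  refine (norm_add_le _ _).trans (add_le_add ((norm_add_le _ _).trans (add_le_add ((norm_add_le _ _).trans
    (add_le_add h1 ?_)) ?_)) h4)
  · rw [norm_mul, norm_mul, Complex.norm_two, Complex.norm_of_nonneg hu0]
    calc 2 * (u : ℝ) * ‖starDrift B ρ₀ x - starDrift B ρ₀ 0‖ ≤ 2 * u * (192 / ρ₀ ^ 2 * |x|) :=
          mul_le_mul_of_nonneg_left h2 (by positivity)
      _ = 384 / ρ₀ ^ 2 * u * |x| := by ring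
  · rw [norm_mul, norm_div, norm_real, Real.norm_eq_abs, norm_pow, hxn,
      show ‖(6 : ℂ)‖ = 6 from by simp]
    calc |starJet3 B| / 6 * |x| ^ 3 ≤ 2 / ρ₀ ^ 2 / 6 * |x| ^ 3 := by gcongr
      _ = 1 / (3 * ρ₀ ^ 2) * |x| ^ 3 := by ring

include hB hU hU0 hu hS hρ₀ hBρ hη in
/-- **The clean one-step bound**: for hulls with `δ₀ ≤ Φ_B'(0)`, missing `ball 0 (8ρ₀)`, `ρ₀ ≤ 1`,
and steps with `η = stepSize S u ≤ 1`:

  `|ΔW̃ − imageDriverModel d c₂ u x| ≤ stepK δ₀ ρ₀ · (u η + u² + |x|³ + u |x|)`,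

`x = U_u`, `stepK δ₀ ρ₀ = 200000/(δ₀ ρ₀⁴)` (`|x| ≤ η ≤ 1` absorbs `|x|⁴ ≤ |x|³`).
[cite: LawlerSchrammWerner2003Restriction, §5 (remark after (5.1))] -/
theorem abs_imageDriverStep_sub_model_le_clean (hρ1 : ρ₀ ≤ 1) {δ₀ : ℝ} (hδ0 : 0 < δ₀)
    (hδ : δ₀ ≤ starDeriv B) (hη1 : stepSize S u ≤ 1) :
    |imageDriverStep B U u - imageDriverModel (starDeriv B) (starJet2 B) u (U u)| ≤
      stepK δ₀ ρ₀ * (u * stepSize S u + u ^ 2 + |U u| ^ 3 + u * |U u|) := by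
  obtain ⟨hUu, -, hη0⟩ := abs_driver_le hB hu hS hρ₀ hη
  obtain ⟨hd0, hd1, -⟩ := starDeriv_spec hB
  have hδ1 : δ₀ ≤ 1 := hδ.trans hd1
  have hmain := abs_imageDriverStep_sub_model_le hB hU hU0 hu hS hρ₀ hBρ hη
  have ha0 : 0 ≤ |U u| := abs_nonneg _
  have hu0 : (0 : ℝ) ≤ u := u.coe_nonneg
  have hx1 : |U u| ≤ 1 := hUu.trans hη1
  have hK : stepK δ₀ ρ₀ = 200000 / (δ₀ * ρ₀ ^ 4) := rfl
  have hpos : 0 < δ₀ * ρ₀ ^ 4 := by positivity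
  have hρ2 : ρ₀ ^ 2 ≤ 1 := by nlinarith
  have hρ4le3 : ρ₀ ^ 4 ≤ ρ₀ ^ 3 := by nlinarith [pow_pos hρ₀ 3]
  have hρ4le2 : ρ₀ ^ 4 ≤ ρ₀ ^ 2 := by nlinarith [pow_pos hρ₀ 2]
  -- each coefficient is dominated by `stepK δ₀ ρ₀`
  have e1 : 25000 * u * (stepSize S u * ρ₀ + u) / (starDeriv B * ρ₀ ^ 3) ≤
      stepK δ₀ ρ₀ * (u * stepSize S u + u ^ 2) := by
    rw [hK, div_mul_eq_mul_div, div_le_div_iff₀ (by positivity) hpos]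
    have h2 : (u : ℝ) * (stepSize S u * ρ₀ + u) ≤ u * stepSize S u + u ^ 2 := by
      have : stepSize S u * ρ₀ ≤ stepSize S u := mul_le_of_le_one_right hη0.le hρ1
      nlinarith only [this, hu0]
    have h3 : δ₀ * ρ₀ ^ 4 ≤ starDeriv B * ρ₀ ^ 3 := by
      calc δ₀ * ρ₀ ^ 4 ≤ starDeriv B * ρ₀ ^ 4 := mul_le_mul_of_nonneg_right hδ (by positivity)
        _ ≤ starDeriv B * ρ₀ ^ 3 := mul_le_mul_of_nonneg_left hρ4le3 hd0.le
    have h4 := mul_le_mul h2 h3 hpos.le (by positivity)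
    have h5 : 0 ≤ ((u : ℝ) * stepSize S u + u ^ 2) * (starDeriv B * ρ₀ ^ 3) := by positivity
    nlinarith only [h4, h5]
  have hK384 : 384 / ρ₀ ^ 2 ≤ stepK δ₀ ρ₀ := by
    rw [hK, div_le_div_iff₀ (by positivity) hpos]; nlinarith [pow_pos hρ₀ 2]
  have hK9 : 1 / (3 * ρ₀ ^ 2) + 8 / ρ₀ ^ 3 ≤ stepK δ₀ ρ₀ := by
    have : 1 / (3 * ρ₀ ^ 2) + 8 / ρ₀ ^ 3 = (ρ₀ + 24) / (3 * ρ₀ ^ 3) := by field_simp; ring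
    rw [this, hK, div_le_div_iff₀ (by positivity) hpos]; nlinarith [pow_pos hρ₀ 3]
  have e2 : 384 / ρ₀ ^ 2 * u * |U u| ≤ stepK δ₀ ρ₀ * (u * |U u|) := by
    rw [mul_assoc]; exact mul_le_mul_of_nonneg_right hK384 (by positivity)
  have e3 : 1 / (3 * ρ₀ ^ 2) * |U u| ^ 3 + 8 / ρ₀ ^ 3 * |U u| ^ 4 ≤ stepK δ₀ ρ₀ * |U u| ^ 3 := by
    have hx4 : |U u| ^ 4 ≤ |U u| ^ 3 := by
      rw [show |U u| ^ 4 = |U u| ^ 3 * |U u| by ring]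
      exact mul_le_of_le_one_right (by positivity) hx1
    calc 1 / (3 * ρ₀ ^ 2) * |U u| ^ 3 + 8 / ρ₀ ^ 3 * |U u| ^ 4
        ≤ 1 / (3 * ρ₀ ^ 2) * |U u| ^ 3 + 8 / ρ₀ ^ 3 * |U u| ^ 3 := by gcongr
      _ = (1 / (3 * ρ₀ ^ 2) + 8 / ρ₀ ^ 3) * |U u| ^ 3 := by ring
      _ ≤ stepK δ₀ ρ₀ * |U u| ^ 3 := mul_le_mul_of_nonneg_right hK9 (by positivity)
  calc _ ≤ _ := hmain
    _ ≤ stepK δ₀ ρ₀ * (u * stepSize S u + u ^ 2) + stepK δ₀ ρ₀ * (u * |U u|) + stepK δ₀ ρ₀ * |U u| ^ 3 := by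
        linarith
    _ = stepK δ₀ ρ₀ * (u * stepSize S u + u ^ 2 + |U u| ^ 3 + u * |U u|) := by ring

end Loewner

end Literature.Probability.RandomPlanarGeometry

end
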